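import HarnessLib
import Summits.RiemannHypothesis.RiemannHypothesis.Theorems.SignConePointwiseCertThirteenTenths
import Summits.RiemannHypothesis.RiemannHypothesis.Theorems.SignConePointwiseIdentity
import Summits.RiemannHypothesis.RiemannHypothesis.Theorems.SignConeUnitSlackReduction

/-!
# Route SignCone: the unit-slack sign-cone inequality UNCONDITIONALLY up to the cut-off `a ≤ 13/10`

Items stmt-RiemannHypothesis-16302 `SignConeOscillatory` (crux) and stmt-RiemannHypothesis-16301
`SignConeInequality` (target). Previous unconditional rungs: `a ≤ 4/5` without primes
(`SignConeSignConeOscillatoryUpToFourFifths.lean`), `a ≤ 1` with fake primes on `{2,3,4,5,7}`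
(`SignConeSignConeOscillatoryUpToOne.lean`). Here the rung is pushed to `a ≤ 13/10` — window
`(-2.6, 2.6)`, nodes `log 2, …, log 13` inside — with the kernel-checked pointwise certificate
`pwCert13s` (`SignConePointwiseCertThirteenTenths*.lean`, fast checker
`SignConePointwiseCheckerFast.lean`): for EVERY real `y`,

  `0 ≤ Re ψ(1/4 + iy/2) − log π + 1 + Ê_χ(y) − Σ_{n = 3}^{12} a_n cos(y log n)`

(`a = (0.60057, 0.69308, 0.42845, 0.44084, 0.81646, 0.49376, 0.69020, 0.52193, 0.64028, 0.01028)` on `n = 3, …, 12`, i.e. fake weights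
`c_n = a_n √n / 2 ≈ (0.52, 0.69, 0.48, 0.54, 1.08, 0.70, 1.04, 0.83, 1.06, 0.02)` — a point of the dual cone `K♭_{13/10}`; the LP puts no weight on
`n = 2`), whence by the spectral identity `slackFunctional_eq_spectralIntegral`
(`SignConePointwiseIdentity.lean`; kernel `E_χ` of the certificate, `= e^{x/2} + e^{-x/2}` on
`[-2.6, 2.6]`) the antecedent of `ConeMagnification` at the cutoff `b = 13/10`
(`fakeWeight_unitSlack_thirteen_tenths`), and by `SignConeUnitSlackReduction.lean` the route items
for all `a ≤ 13/10` (`signConeInequality_upTo_thirteen_tenths`,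
`signConeOscillatory_upTo_thirteen_tenths`, bodies verbatim).
-/

noncomputable section

-- `Summit.RiemannHypothesis.RiemannHypothesis.…` repeats a namespace component by design (D-0017 layout).
set_option linter.dupNamespace false

open scoped BigOperators ComplexConjugate
open Complex MeasureTheory Set Filter

namespace Summit.RiemannHypothesis.RiemannHypothesis.Theorems.SignCone

open Literature.NumberTheory.LFunctions

/-- The fake weights of the certificate: `c_n = a_n √n / 2`. [folklore] -/
theorem pwCert13s_a_nonneg (n : ℕ) : 0 ≤ pwCert13s.a n := by
  show 0 ≤ (if n = 3 then 60057/100000 else if n = 4 then 17327/25000 else if n = 5 then 8569/20000 else if n = 6 then 11021/25000 else if n = 7 then 40823/50000 else if n = 8 then 1543/3125 else if n = 9 then 3451/5000 else if n = 10 then 52193/100000 else if n = 11 then 16007/25000 else if n = 12 then 257/25000 else 0 : ℚ)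
  split_ifs <;> norm_num

/-- The weights vanish off the node list `[3, 4, 5, 6, 7, 8, 9, 10, 11, 12]`. [folklore] -/
theorem pwCert13s_a_eq_zero {n : ℕ} (hn : n ∉ pwCert13s.nodeList.toFinset) : pwCert13s.a n = 0 := by
  have h : ¬ (n = 3 ∨ n = 4 ∨ n = 5 ∨ n = 6 ∨ n = 7 ∨ n = 8 ∨ n = 9 ∨ n = 10 ∨ n = 11 ∨ n = 12) := by
    intro h'
    apply hn
    show n ∈ ([3, 4, 5, 6, 7, 8, 9, 10, 11, 12] : List ℕ).toFinset
    simp only [List.toFinset_cons, List.toFinset_nil, Finset.mem_insert, Finset.notMem_empty, or_false]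
    exact h'
  push Not at h
  obtain ⟨h3, h4, h5, h6, h7, h8, h9, h10, h11, h12⟩ := h
  show (if n = 3 then 60057/100000 else if n = 4 then 17327/25000 else if n = 5 then 8569/20000 else if n = 6 then 11021/25000 else if n = 7 then 40823/50000 else if n = 8 then 1543/3125 else if n = 9 then 3451/5000 else if n = 10 then 52193/100000 else if n = 11 then 16007/25000 else if n = 12 then 257/25000 else 0 : ℚ) = 0
  simp [h3, h4, h5, h6, h7, h8, h9, h10, h11, h12]

/-- **The antecedent of `ConeMagnification` at cut-off `13/10` with an explicit fake weight**:
`-‖g‖₂² ≤ Re (W_ar(g ⋆ g̃) − P_c(g ⋆ g̃))` for every Weil test `g` supported in `[-13/10, 13/10]`, with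
`c_n = a_n √n/2` on `n ∈ {3, …, 12}` (kernel-checked pointwise certificate `pwCert13s`). [folklore] -/
theorem fakeWeight_unitSlack_thirteen_tenths :
    ∀ g : ℝ → ℂ, IsWeilTest g → tsupport g ⊆ Icc (-(13 / 10 : ℝ)) (13 / 10) →
      -(∫ t, ‖g t‖ ^ 2) ≤ (weilPolarTerm (weilConv g (weilReflect g)) + weilArchTerm (weilConv g (weilReflect g)) -
        ∑' n : ℕ, (((fun n : ℕ => (pwCert13s.a n : ℝ) * Real.sqrt n / 2) n : ℝ) : ℂ) / (Real.sqrt n : ℂ) *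
          (weilConv g (weilReflect g) (Real.log n) + weilConv g (weilReflect g) (-Real.log n))).re := by
  intro g hg hsupp
  have hh : (0 : ℚ) < pwCert13s.d.h := by show (0 : ℚ) < 1 / 8; norm_num
  have hL : pwCert13s.d.L = 13 / 5 := rfl
  -- the kernel of the certificate on the window [-2.6, 2.6]
  have hEeq : ∀ x ∈ Icc (-(2 * (13 / 10 : ℝ))) (2 * (13 / 10)),
      pwCert13s.d.kernelE x = Real.exp (x / 2) + Real.exp (-(x / 2)) := by
    intro x hx
    refine PWKernel.kernelE_eq_of_abs_le hh ?_
    rw [hL]; push_cast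
    exact abs_le.2 ⟨by linarith [hx.1], by linarith [hx.2]⟩
  -- the pointwise certificate
  have hF : ∀ y : ℝ, 0 ≤ Literature.Analysis.SpecialFunctions.reDigammaQuarter y - Real.log Real.pi +
      ((pwCert13s.s : ℚ) : ℝ) + cosTransform pwCert13s.d.kernelE y -
        ∑ n ∈ pwCert13s.nodeList.toFinset, (fun n : ℕ => ((pwCert13s.a n : ℚ) : ℝ)) n * Real.cos (y * Real.log n) :=
    pwCert13s_F_nonneg
  have hs : ((pwCert13s.s : ℚ) : ℝ) = 1 := by show (((1 : ℚ)) : ℝ) = 1; norm_num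
  have h := neg_slack_le_of_density_nonneg hg hsupp (PWKernel.continuous_kernelE _)
    (PWKernel.hasCompactSupport_kernelE hh) hEeq ((pwCert13s.s : ℚ) : ℝ) pwCert13s.nodeList.toFinset
    (fun n : ℕ => ((pwCert13s.a n : ℚ) : ℝ)) hF
  rw [hs, one_mul] at h
  -- the finite sum as the `tsum` of the route form
  have hts : (∑' n : ℕ, (((fun n : ℕ => (pwCert13s.a n : ℝ) * Real.sqrt n / 2) n : ℝ) : ℂ) / (Real.sqrt n : ℂ) *
      (weilConv g (weilReflect g) (Real.log n) + weilConv g (weilReflect g) (-Real.log n))) =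
      ∑ n ∈ pwCert13s.nodeList.toFinset, (((pwCert13s.a n : ℚ) : ℝ) / 2 : ℝ) *
        (weilConv g (weilReflect g) (Real.log n) + weilConv g (weilReflect g) (-Real.log n)) := by
    have hpt : ∀ n : ℕ, (((fun n : ℕ => (pwCert13s.a n : ℝ) * Real.sqrt n / 2) n : ℝ) : ℂ) / (Real.sqrt n : ℂ) =
        ((((pwCert13s.a n : ℚ) : ℝ) / 2 : ℝ) : ℂ) := by
      intro n
      rcases Nat.eq_zero_or_pos n with rfl | hn
      · have h0 : pwCert13s.a 0 = 0 := pwCert13s_a_eq_zero (by decide)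
        simp [h0]
      · have hsq : (Real.sqrt n : ℂ) ≠ 0 := by
          exact_mod_cast (Real.sqrt_pos.2 (by exact_mod_cast hn)).ne'
        field_simp
        push_cast
        ring
    simp_rw [hpt]
    refine tsum_eq_sum fun n hn => ?_
    rw [pwCert13s_a_eq_zero hn]
    push_cast
    ring
  rw [hts]
  exact h

/-- The fake weights are non-negative. [folklore] -/
theorem fakeWeight_thirteen_tenths_nonneg (n : ℕ) : 0 ≤ (pwCert13s.a n : ℝ) * Real.sqrt n / 2 := by
  have := pwCert13s_a_nonneg n
  have h1 : (0 : ℝ) ≤ pwCert13s.a n := by exact_mod_cast this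
  positivity

/-- **The unit-slack sign-cone inequality up to `13/10`, Literature form.** For every finite family of Weil
tests `gᵢ` supported in `[-b, b]`, `b ≤ 13/10`, and `F = Σᵢ gᵢ ⋆ g̃ᵢ` node-nonnegative:
`-Re F(0) ≤ Re W_ar(F)`. [folklore] -/
theorem neg_re_apply_zero_le_re_weilArchPolar_of_tsupport_subset_thirteen_tenths {b : ℝ} (hb : b ≤ 13 / 10)
    {k : ℕ} {g : Fin k → ℝ → ℂ} {F : ℝ → ℂ} (hF : F = fun t => ∑ i, weilConv (g i) (weilReflect (g i)) t)
    (hg : ∀ i, IsWeilTest (g i)) (hsupp : ∀ i, tsupport (g i) ⊆ Icc (-b) b)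
    (hn : ∀ n : ℕ, 2 ≤ n → 0 ≤ (F (Real.log n)).re) :
    -(F 0).re ≤ (weilPolarTerm F + weilArchTerm F).re :=
  neg_re_apply_zero_le_re_weilArchPolar_of_fakeWeight_unitSlack (b := 13 / 10)
    (c := fun n : ℕ => (pwCert13s.a n : ℝ) * Real.sqrt n / 2) fakeWeight_thirteen_tenths_nonneg fakeWeight_unitSlack_thirteen_tenths hF hg
    (fun i => (hsupp i).trans (Icc_subset_Icc (neg_le_neg hb) hb)) hn

/-- **`SignConeInequality` (route target, stmt-RiemannHypothesis-16301) UNCONDITIONALLY for all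
cut-offs `a ≤ 13/10`** — the item's body verbatim with the extra hypothesis `a ≤ 13/10`. [folklore] -/
theorem signConeInequality_upTo_thirteen_tenths :
    ∀ a : ℝ, 0 < a → a ≤ 13 / 10 → ∀ (k : ℕ) (g : Fin k → ℝ → ℂ), (∀ i, (ContDiff ℝ ((⊤ : ℕ∞) : WithTop ℕ∞) (g i) ∧ HasCompactSupport (g i)) ∧ tsupport (g i) ⊆ Set.Icc (-a) a) → let F : ℝ → ℂ := fun t => ∑ i, MeasureTheory.convolution (g i) (fun u => (starRingEnd ℂ) ((g i) (-u))) (ContinuousLinearMap.mul ℂ ℂ) MeasureTheory.MeasureSpace.volume t; (∀ n : ℕ, 2 ≤ n → 0 ≤ (F (Real.log n)).re) → let M : ℂ → ℂ := fun s => ∫ u : ℝ, F u * Complex.exp ((s - 1 / 2) * u); -(F 0).re ≤ (M 0 + M 1 + ((1 / (2 * Real.pi) : ℂ) * (∫ t : ℝ, M (1 / 2 + t * Complex.I) * ((Complex.digamma (1 / 4 + t / 2 * Complex.I)).re : ℂ)) - F 0 * (Real.log Real.pi : ℂ))).re := by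
  intro a _ha hab k g hg F hn M
  exact neg_re_apply_zero_le_re_weilArchPolar_of_tsupport_subset_thirteen_tenths (b := a) hab (g := g) (F := F)
    rfl (fun i => (hg i).1) (fun i => (hg i).2) hn

/-- **`SignConeOscillatory` (route crux, stmt-RiemannHypothesis-16302) UNCONDITIONALLY for all
cut-offs `a ≤ 13/10`** — the item's body verbatim with the extra hypothesis `a ≤ 13/10` (previous
rungs: `563/1024` exact cone, `4/5` without primes, `1` with fake primes). [folklore] -/
theorem signConeOscillatory_upTo_thirteen_tenths :
    ∀ a : ℝ, 0 < a → a ≤ 13 / 10 → ∀ (k : ℕ) (g : Fin k → ℝ → ℂ), (∀ i, (ContDiff ℝ ((⊤ : ℕ∞) : WithTop ℕ∞) (g i) ∧ HasCompactSupport (g i)) ∧ tsupport (g i) ⊆ Set.Icc (-a) a) → let F : ℝ → ℂ := fun t => ∑ i, MeasureTheory.convolution (g i) (fun u => (starRingEnd ℂ) ((g i) (-u))) (ContinuousLinearMap.mul ℂ ℂ) MeasureTheory.MeasureSpace.volume t; (∀ n : ℕ, 2 ≤ n → 0 ≤ (F (Real.log n)).re) → (∃ t : ℝ, Real.log 2 ≤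 |t| ∧ (F t).re < 0) → let M : ℂ → ℂ := fun s => ∫ u : ℝ, F u * Complex.exp ((s - 1 / 2) * u); -(F 0).re ≤ (M 0 + M 1 + ((1 / (2 * Real.pi) : ℂ) * (∫ t : ℝ, M (1 / 2 + t * Complex.I) * ((Complex.digamma (1 / 4 + t / 2 * Complex.I)).re : ℂ)) - F 0 * (Real.log Real.pi : ℂ))).re :=
  signConeOscillatory_upTo_of_fakeWeight_unitSlack (b := 13 / 10)
    (c := fun n : ℕ => (pwCert13s.a n : ℝ) * Real.sqrt n / 2) fakeWeight_thirteen_tenths_nonneg fakeWeight_unitSlack_thirteen_tenths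

end Summit.RiemannHypothesis.RiemannHypothesis.Theorems.SignCone

end
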